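import Summits.ABC.ABC.Theses.ParitySliceConcordantNorms

/-!
# Birth skeleton — crux `SquareTopResidualFinite` (stmt-ABC-4015)

Route `route-ABC-parity-slice-concordant-norms`; crux decl
`Summit.ABC.ABC.Theses.ParitySliceConcordantNorms.SquareTopResidualFinite`:
the residual set `R⁺` of square-top abc triples `(a, b, c)` on which all six Belyi breedings fail,

  `c = □ ∧ (b = □ ∨ 3b ≤ a) ∧ (a = □ ∨ 3a ≤ b) ∧ (a + 3b ∈ {□, 3□}) ∧ (3a + b ∈ {□, 3□})`
  `∧ (a ≤ 2b ∨ a - b = □) ∧ (b ≤ 2a ∨ b - a = □)`,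

is finite.

## The line (split by which legs are squares)

* **no leg a square** ⇒ `3b ≤ a ∧ 3a ≤ b`, impossible for `a > 0` (done inside the assembly);
* **both legs squares** (`a = α²`, `b = β²`, `c = γ²`, a primitive Pythagorean triple) with
  `α² + 3β² ∈ {□, 3□}` and `3α² + β² ∈ {□, 3□}`: the combination `(3□, 3□)` forces `3 ∣ α` and
  `3 ∣ β` (done inside the assembly); every other combination contains Euler's concordant pair
  `x² + y² = □ ∧ x² + 3y² = □`, which forces `xy = 0` — `stub_concordantOneThree`
  (rank `E(1,3) = 0`, `E(1,3) : Y² = X(X+1)(X+3)`; Ono 1996; elementary 2-isogeny descent);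
* **exactly one leg a square** (`a = α²`, say — the mirror `b = β²` is symmetric): then `3b ≤ a`,
  hence `a > 2b` and `a - b = δ²`; with `c = γ²` this is `δ² + γ² = 2α²` (three squares
  `δ² < α² < γ²` in arithmetic progression with common difference `b`), in the region `3γ² ≤ 4α²`,
  with `a + 3b = 3γ² - 2α² ∈ {□, 3□}` and `3a + b = 2α² + γ² ∈ {□, 3□}`.  The 2-adic obstruction
  `stub_squaresAPLocal` (`δ, α, γ` odd ⇒ `2α² + γ² ≡ 3`, `9γ² - 6α² ≡ 3 (mod 8)`) kills
  `2α² + γ² = □` and `3(3γ² - 2α²) = □`, leaving the single system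
  `3γ² - 2α² = □ ∧ 3(2α² + γ²) = □` — the refuters' `A(1,3)`: a smooth complete intersection of three
  diagonal quadrics in `ℙ⁴`, genus 5, all five elliptic quotients of positive rank — whose finiteness is
  `stub_squaresAPHard`, the load-bearing (Faltings-grade) stub.

Stubs (sorried, registered): `stub_squaresAPHard` (hardest), `stub_squaresAPLocal`,
`stub_concordantOneThree`.  Assembly: `SquareTopResidualFinite_of_stubs : <stub₁> → <stub₂> → <stub₃> →
<crux statement>` is sorry-free (axioms `propext, Classical.choice, Quot.sound`), and the registrar-shape
skeleton theorem `SquareTopResidualFinite_of : SquareTopResidualFinite := SquareTopResidualFinite_of_stubs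
stub_squaresAPHard stub_squaresAPLocal stub_concordantOneThree` concludes the route decl BY NAME (the only
`sorry`s it depends on are the three stubs).  Sources: Faltings1983Endlichkeit (Satz 7; tree fact
`Literature.NumberTheory.DiophantineGeometry.finite_algPoints_of_two_le_genus`, not instantiable today),
Ono 1996 (Acta Arith. 78, doi:10.4064/aa-78-2-101-123), deWeger2023Fudge; refuter notes O2 (g0, g2) and
grounder g20-58 on stmt-ABC-4015.
-/

namespace Summit.ABC.ABC.Cruxes.SquareTopResidualFinite.Birth

open Literature.NumberTheory.DiophantineGeometry

/-! ### Stubs -/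

/-- **STUB (hardest; Faltings-grade).** Primitive triples of squares `δ² < α² < γ²` in arithmetic
progression (`δ² + γ² = 2α²`, `gcd(α, γ) = 1`), in the region `3γ² ≤ 4α²`, for which `3γ² - 2α²` is a
square and `3(2α² + γ²)` is a square, are finite in number.  This is the residual system `A(1,3)`
(`a = α²` a square leg, `b = α² - δ²`, `c = γ²`, `a + 3b = □`, `3a + b = 3□`): a smooth complete
intersection of three diagonal quadrics in `ℙ⁴`, a curve of genus 5, finite over `ℚ` by Faltings 1983
Satz 7; all five of its elliptic quotients have positive rank (refuter g2 on stmt-ABC-4015), so no rank-0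
descent is known — Faltings (tree fact `finite_algPoints_of_two_le_genus`, instantiation needed) or a new
idea.  Conjecturally the set is empty (no point with chord parameter `m < 1200`; `R⁺ ∩ {c ≤ 6·10⁴} = ∅`). -/
theorem stub_squaresAPHard :
    Set.Finite {q : ℕ × ℕ × ℕ | 0 < q.1 ∧ q.1 < q.2.1 ∧ Nat.Coprime q.2.1 q.2.2 ∧
      q.1 ^ 2 + q.2.2 ^ 2 = 2 * q.2.1 ^ 2 ∧ 3 * q.2.2 ^ 2 ≤ 4 * q.2.1 ^ 2 ∧
      IsSquare (3 * q.2.2 ^ 2 - 2 * q.2.1 ^ 2) ∧ IsSquare (3 * (2 * q.2.1 ^ 2 + q.2.2 ^ 2))} := by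
  sorry

/-- **STUB (2-adic obstruction; decide-grade).** If `δ² + γ² = 2α²` with `gcd(α, γ) = 1` then
`δ, α, γ` are all odd, so `2α² + γ² ≡ 3 (mod 8)` and `9γ² - 6α² ≡ 3 (mod 8)` are not squares.
Kills the residual systems `A(1,1)`, `A(3,1)`, `A(3,3)` (and their mirrors). -/
theorem stub_squaresAPLocal :
    ∀ δ α γ u : ℕ, Nat.Coprime α γ → δ ^ 2 + γ ^ 2 = 2 * α ^ 2 →
      2 * α ^ 2 + γ ^ 2 ≠ u ^ 2 ∧ 6 * α ^ 2 + u ^ 2 ≠ 9 * γ ^ 2 := by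
  sorry

/-- **STUB (Euler's concordant forms `(1, 3)`; rank-0 2-descent).** `x² + y²` and `x² + 3y²` are not
both squares unless `xy = 0`: the curve `E(1,3) : Y² = X(X+1)(X+3)` has rank 0 and torsion `E[2]`
(Ono 1996, doi:10.4064/aa-78-2-101-123, pp. 105, 110; the 2-isogeny descent of Silverman–Tate III.6 done by
hand in the refuter notes on stmt-ABC-4015: `#α(Γ) = 4`, `#ᾱ(Γ̄) = 1`).  Kills the residual systems
`B(1,1)`, `B(1,3)`, `B(3,1)`.  (Mathlib has no descent machinery; cf. the tree's
`Literature/NumberTheory/EllipticCurves/Curve24A1Descent.lean` for the pattern.) -/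
theorem stub_concordantOneThree :
    ∀ x y : ℕ, IsSquare (x ^ 2 + y ^ 2) → IsSquare (x ^ 2 + 3 * y ^ 2) → x = 0 ∨ y = 0 := by
  sorry

/-! ### Assembly (sorry-free) -/

/-- Case B of the residual (both legs squares) is empty, given the concordant-form stub. -/
theorem caseB_false
    (hconc : ∀ x y : ℕ, IsSquare (x ^ 2 + y ^ 2) → IsSquare (x ^ 2 + 3 * y ^ 2) → x = 0 ∨ y = 0)
    {α β γ : ℕ} (ha : 0 < α * α) (hb : 0 < β * β) (hsum : α * α + β * β = γ * γ)
    (hcop : Nat.Coprime (α * α) (β * β))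
    (h3 : IsSquare (α * α + 3 * (β * β)) ∨ IsSquare (3 * (α * α + 3 * (β * β))))
    (h4 : IsSquare (3 * (α * α) + β * β) ∨ IsSquare (3 * (3 * (α * α) + β * β))) : False := by
  have hα : α ≠ 0 := by rintro rfl; simp at ha
  have hβ : β ≠ 0 := by rintro rfl; simp at hb
  have hpy : IsSquare (α ^ 2 + β ^ 2) := ⟨γ, by rw [sq, sq, hsum]⟩
  have hpy' : IsSquare (β ^ 2 + α ^ 2) := by rwa [add_comm]
  rcases h3 with h3 | h3
  · have h3' : IsSquare (α ^ 2 + 3 * β ^ 2) := by rwa [sq, sq]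
    rcases hconc α β hpy h3' with h | h
    · exact hα h
    · exact hβ h
  rcases h4 with h4 | h4
  · have h4' : IsSquare (β ^ 2 + 3 * α ^ 2) := by rw [sq, sq, add_comm]; exact h4
    rcases hconc β α hpy' h4' with h | h
    · exact hβ h
    · exact hα h
  -- the `(3□, 3□)` combination: `3 ∣ α` and `3 ∣ β`, contradicting coprimality
  obtain ⟨r, hr⟩ := h3
  obtain ⟨s, hs⟩ := h4
  have h3r : 3 ∣ r := by
    have : 3 ∣ r * r := ⟨α * α + 3 * (β * β), hr.symm⟩
    exact (Nat.prime_three.dvd_mul.mp this).elim id id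
  have h3s : 3 ∣ s := by
    have : 3 ∣ s * s := ⟨3 * (α * α) + β * β, hs.symm⟩
    exact (Nat.prime_three.dvd_mul.mp this).elim id id
  have h9r : 9 ∣ r * r := Nat.mul_dvd_mul h3r h3r
  have h9s : 9 ∣ s * s := Nat.mul_dvd_mul h3s h3s
  rw [← hr] at h9r
  rw [← hs] at h9s
  have h3a : 3 ∣ α * α := by omega
  have h3b : 3 ∣ β * β := by omega
  have h3α : 3 ∣ α := (Nat.prime_three.dvd_mul.mp h3a).elim id id
  have h3β : 3 ∣ β := (Nat.prime_three.dvd_mul.mp h3b).elim id id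
  have h31 : 3 ∣ Nat.gcd (α * α) (β * β) :=
    Nat.dvd_gcd (dvd_mul_of_dvd_left h3α α) (dvd_mul_of_dvd_left h3β β)
  rw [Nat.Coprime.gcd_eq_one hcop] at h31
  exact absurd h31 (by norm_num)

/-- Case A of the residual (`a = α²` a square leg with `3b ≤ a`): the triple comes from a point of
the hard AP system, given the 2-adic stub. -/
theorem caseA_aux
    (hloc : ∀ δ α γ u : ℕ, Nat.Coprime α γ → δ ^ 2 + γ ^ 2 = 2 * α ^ 2 →
      2 * α ^ 2 + γ ^ 2 ≠ u ^ 2 ∧ 6 * α ^ 2 + u ^ 2 ≠ 9 * γ ^ 2)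
    {α b γ : ℕ} (hb0 : 0 < b) (hsum : α * α + b = γ * γ) (hcop : Nat.Coprime (α * α) b)
    (h1 : 3 * b ≤ α * α)
    (h3 : IsSquare (α * α + 3 * b) ∨ IsSquare (3 * (α * α + 3 * b)))
    (h4 : IsSquare (3 * (α * α) + b) ∨ IsSquare (3 * (3 * (α * α) + b)))
    (h5 : α * α ≤ 2 * b ∨ IsSquare (α * α - b)) :
    ∃ δ : ℕ, (0 < δ ∧ δ < α ∧ Nat.Coprime α γ ∧ δ ^ 2 + γ ^ 2 = 2 * α ^ 2 ∧
      3 * γ ^ 2 ≤ 4 * α ^ 2 ∧ IsSquare (3 * γ ^ 2 - 2 * α ^ 2) ∧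
      IsSquare (3 * (2 * α ^ 2 + γ ^ 2))) ∧ γ ^ 2 - α ^ 2 = b := by
  have h5' : IsSquare (α * α - b) := h5.resolve_left (by omega)
  obtain ⟨δ, hδ⟩ := h5'
  have hcopαγ : Nat.Coprime α γ := by
    have h : Nat.Coprime (α * α) (γ * γ) := by
      rw [← hsum]; exact Nat.coprime_self_add_right.mpr hcop
    exact (Nat.coprime_mul_iff_right.mp (Nat.coprime_mul_iff_left.mp h).1).1
  have hAP : δ ^ 2 + γ ^ 2 = 2 * α ^ 2 := by rw [sq, sq, sq]; omega
  have e3 : 3 * γ ^ 2 - 2 * α ^ 2 = α * α + 3 * b := by rw [sq, sq]; omega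
  have e4 : 2 * α ^ 2 + γ ^ 2 = 3 * (α * α) + b := by rw [sq, sq]; omega
  have hno4 : ¬ IsSquare (3 * (α * α) + b) := by
    rintro ⟨u, hu⟩
    refine (hloc δ α γ u hcopαγ hAP).1 ?_
    rw [e4, hu, sq]
  have hno3 : ¬ IsSquare (3 * (α * α + 3 * b)) := by
    rintro ⟨u, hu⟩
    refine (hloc δ α γ u hcopαγ hAP).2 ?_
    rw [sq, sq, sq]; omega
  refine ⟨δ, ⟨?_, ?_, hcopαγ, hAP, ?_, ?_, ?_⟩, ?_⟩
  · rcases Nat.eq_zero_or_pos δ with rfl | h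
    · omega
    · exact h
  · by_contra hle
    have hle' : α ≤ δ := not_lt.mp hle
    have := Nat.mul_le_mul hle' hle'
    omega
  · rw [sq, sq]; omega
  · rw [e3]; exact h3.resolve_right hno3
  · rw [e4]; exact h4.resolve_left hno4
  · rw [sq, sq]; omega

/-- Parametrisation of case A (`a` a square leg): `(δ, α, γ) ↦ (α², γ² - α², γ²)`. -/
def toTripleA (q : ℕ × ℕ × ℕ) : ℕ × ℕ × ℕ := (q.2.1 ^ 2, q.2.2 ^ 2 - q.2.1 ^ 2, q.2.2 ^ 2)

/-- Parametrisation of the mirror case A' (`b` a square leg): `(δ, β, γ) ↦ (γ² - β², β², γ²)`. -/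
def toTripleA' (q : ℕ × ℕ × ℕ) : ℕ × ℕ × ℕ := (q.2.2 ^ 2 - q.2.1 ^ 2, q.2.1 ^ 2, q.2.2 ^ 2)

/-- **ASSEMBLY (kernel-checked, no `sorry`).** The three stub statements imply the crux statement
(verbatim the body of `Summit.ABC.ABC.Theses.ParitySliceConcordantNorms.SquareTopResidualFinite`):
`R⁺ ⊆ toTripleA '' Hard ∪ toTripleA' '' Hard`. -/
theorem SquareTopResidualFinite_of_stubs
    (hhard : Set.Finite {q : ℕ × ℕ × ℕ | 0 < q.1 ∧ q.1 < q.2.1 ∧ Nat.Coprime q.2.1 q.2.2 ∧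
      q.1 ^ 2 + q.2.2 ^ 2 = 2 * q.2.1 ^ 2 ∧ 3 * q.2.2 ^ 2 ≤ 4 * q.2.1 ^ 2 ∧
      IsSquare (3 * q.2.2 ^ 2 - 2 * q.2.1 ^ 2) ∧ IsSquare (3 * (2 * q.2.1 ^ 2 + q.2.2 ^ 2))})
    (hloc : ∀ δ α γ u : ℕ, Nat.Coprime α γ → δ ^ 2 + γ ^ 2 = 2 * α ^ 2 →
      2 * α ^ 2 + γ ^ 2 ≠ u ^ 2 ∧ 6 * α ^ 2 + u ^ 2 ≠ 9 * γ ^ 2)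
    (hconc : ∀ x y : ℕ, IsSquare (x ^ 2 + y ^ 2) → IsSquare (x ^ 2 + 3 * y ^ 2) → x = 0 ∨ y = 0) :
    Set.Finite {t : ℕ × ℕ × ℕ | Literature.NumberTheory.DiophantineGeometry.IsABCTriple t.1 t.2.1 t.2.2 ∧
      IsSquare t.2.2 ∧ (IsSquare t.2.1 ∨ 3 * t.2.1 ≤ t.1) ∧ (IsSquare t.1 ∨ 3 * t.1 ≤ t.2.1) ∧
      (IsSquare (t.1 + 3 * t.2.1) ∨ IsSquare (3 * (t.1 + 3 * t.2.1))) ∧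
      (IsSquare (3 * t.1 + t.2.1) ∨ IsSquare (3 * (3 * t.1 + t.2.1))) ∧
      (t.1 ≤ 2 * t.2.1 ∨ IsSquare (t.1 - t.2.1)) ∧ (t.2.1 ≤ 2 * t.1 ∨ IsSquare (t.2.1 - t.1))} := by
  classical
  refine ((hhard.image toTripleA).union (hhard.image toTripleA')).subset ?_
  rintro ⟨a, b, c⟩ ht
  simp only [Set.mem_setOf_eq] at ht
  obtain ⟨⟨ha0, hb0, hsum, hcop⟩, ⟨γ, hγ⟩, h1, h2, h3, h4, h5, h6⟩ := ht
  subst hγ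
  by_cases hsa : IsSquare a <;> by_cases hsb : IsSquare b
  · -- case B: both legs squares — impossible
    exfalso
    obtain ⟨α, rfl⟩ := hsa
    obtain ⟨β, rfl⟩ := hsb
    exact caseB_false hconc ha0 hb0 hsum hcop h3 h4
  · -- case A: `a = α²`, `b` not a square
    obtain ⟨α, rfl⟩ := hsa
    obtain ⟨δ, hmem, hb⟩ := caseA_aux hloc hb0 hsum hcop (h1.resolve_left hsb) h3 h4 h5
    refine Set.mem_union_left _ ((Set.mem_image _ _ _).2 ⟨(δ, α, γ), hmem, ?_⟩)
    simp only [toTripleA, Prod.mk.injEq]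
    exact ⟨sq α, hb, sq γ⟩
  · -- case A': `b = β²`, `a` not a square (mirror image of case A)
    obtain ⟨β, rfl⟩ := hsb
    have hsum' : β * β + a = γ * γ := by rw [add_comm]; exact hsum
    have h3' : IsSquare (β * β + 3 * a) ∨ IsSquare (3 * (β * β + 3 * a)) :=
      h4.imp (fun h => by rwa [add_comm] at h) (fun h => by rwa [add_comm (3 * a)] at h)
    have h4' : IsSquare (3 * (β * β) + a) ∨ IsSquare (3 * (3 * (β * β) + a)) :=
      h3.imp (fun h => by rwa [add_comm] at h) (fun h => by rwa [add_comm a] at h)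
    obtain ⟨δ, hmem, ha⟩ :=
      caseA_aux hloc ha0 hsum' hcop.symm (h2.resolve_left hsa) h3' h4' h6
    refine Set.mem_union_right _ ((Set.mem_image _ _ _).2 ⟨(δ, β, γ), hmem, ?_⟩)
    simp only [toTripleA', Prod.mk.injEq]
    exact ⟨ha, sq β, sq γ⟩
  · -- neither leg a square: `3b ≤ a` and `3a ≤ b` — impossible for `a > 0`
    exfalso
    have := h1.resolve_left hsb
    have := h2.resolve_left hsa
    omega

/-- **THE SKELETON THEOREM (registrar shape).** The crux
`Summit.ABC.ABC.Theses.ParitySliceConcordantNorms.SquareTopResidualFinite`, concluded BY NAME from the three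
declared stubs through the sorry-free assembly `SquareTopResidualFinite_of_stubs`; the only `sorry`s in its
closure are `stub_squaresAPHard`, `stub_squaresAPLocal`, `stub_concordantOneThree`. -/
theorem SquareTopResidualFinite_of :
    Summit.ABC.ABC.Theses.ParitySliceConcordantNorms.SquareTopResidualFinite :=
  SquareTopResidualFinite_of_stubs stub_squaresAPHard stub_squaresAPLocal stub_concordantOneThree

end Summit.ABC.ABC.Cruxes.SquareTopResidualFinite.Birth
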